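import Summits.QuantumFields.BalabanUV.T4Continuum.Support.T4TrajectoryDensityPerWindow

/-!
# `T4Continuum.T4TrajectoryDensityPerSliceWindow` — PER-STEP SLICE WINDOWS: the `_win` chain of `T4TrajectoryDensityPerWindow`
# with the direction windows of EVERY slice (births, the step operation's slice, the action exponent, the centred perturbation)
# read at the generation's per-step chart window `wk b k′ k` instead of the uniform `w` (cell `pub-balaban`, sub-cell `t4`,
# spine estimate NE1′ (node O3b/H2); NE1′ formalisation swarm `b2b-balaban-t4-ne1p-formalise-*`, leaf prover 04 — located finding
# F-ne1pleaf04-1, HOME/CLAIMS.log 2026-08-20T08:57Z; tree target `Summits/QuantumFields/BalabanUV/T4Continuum/Support/`; ADDITIVE —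
# imports leaf-08's `T4TrajectoryDensityPerWindow` (p212994) ONLY; a parallel `_swin` chain over the same one-step lemmas of
# `T4TrajectoryModulus` ∕ `T4TrajectoryDensity` ∕ `T4TrajectoryDensityDressed` BY NAME; modifies nothing)

HONEST FRAMING.  Finite four-torus, rung (B)+1 only — NOT infinite volume, NOT a mass gap, NOT the Clay problem, NOT summit
progress.  «continuum YM on T⁴ ⇐ BetaPertH ∧ nine spine estimates (0/9 proved); BetaPertH ⇐ (D1) ∧ (D4) ∧ CAP+tail; G-an2-4
gates asym, D1 and NE2/3/4».  [folklore] kernel glue (the lineage's proofs re-run with the slice window indexed per step), 0 sorry,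
0 citations; nothing of Bałaban's densities or the cell's D-terms is asserted — births, the step law, the action binders, the
window geometry, the defects and their rate stay binders ((w1), H2, (w2-act), (w3)⁺, (I4′)).

WHY (finding F-ne1pleaf04-1, after F-ne1pleaf08-1 (4)).  `T4TrajectoryDensityPerWindow` re-cut the OWN-family nesting (N2) to the
per-step chart window `wk b k′ (k+1)`, but every SLICE of the chain — births `hsl`, the operator slice `hop`/`hEsl`, hence
END-F-win's `hE`/`hP` — stayed on the uniform direction window `w`.  The centred perturbation `hP` is ASSEMBLED
(`T4TrajectoryDensityAssembly(Mod)(Win).pertSlice_under_history…`) through the cross-family complex margin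
`hN2cx : … latN pd ≤ w → ∀ t ∈ tube (ϱ₁ b k / latN pd), latMove U₀ pd t + z₁ b k ∈ 𝒦 p.1 p.2 k`, whose direction bound is the
OUTPUT slice's window; for bond-ball windows this forces the gap `ρw (k+1) + w + ϱ₁ k + σ k ≤ ρw k`, i.e. `K·w` of birth window
along a family met at `K` scales (`WindowSchedule.window_budget`) — cutoff-dependent (caveat k1).  The slice shapes
`BirthSlice`/`OpSliceOn`/`ExponentSliceAt`/`PertSlice` are `∀ d, 0 < N d → N d ≤ w → …`, ANTITONE in the window, and the chain
tests a slice only along the direction of a windowed pair (`bgLip_of_opSlice … hadm.1 hadm.2`) or one admissible direction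
(`supCost_of_opSliceOn`), so reading every slice at `wk b k′ (k+1)` changes NO constant and NO conclusion; downstream the
assembled `hP` then needs `hN2cx` only for `latN pd ≤ wk b k′ (k+1)` — a summable consumption.

CONTENTS (§25 of the (w2)-split numbering; §24 = leaf-02's `T4TrajectoryDensityGatedNull`).
* `contStepLawOn_of_opSlice_windowed₃` — leaf-08's `…windowed₂` with the operation's slice `hEsl` on the upper guard `w₁`.
* `respMod_windowed_of_raw` — a raw modulus of range `w′` is a modulus of any range on the pairs windowed at `w′`.
* `transportsFromVar_of_opSlices_fam_swin`, `transportsFromVar_of_linearOpSlicesOn_fam_swin`,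
  `transportsFromVar_of_linearOpSlicesOn_lattice_fam_swin`, and the gated dressed-centred capstone
  **`transportsFromVar_of_centredExponent_lattice_fam_gated_swin`** — the `_win` theorems VERBATIM except: `hsl` on `wk b k′ k′`,
  `hop`/`hE`/`hP` on `wk b k′ (k+1)`, `hdir` inside that window, no `hw`.  SAME conclusion
  `T.TransportsFromVar (4c_δ/r) (fun i => ψ·α i) Gate`.  The Spine face (END-F-swin, `Gate := budgetGate`) is
  `Spine/NE1p/DressedRootSliceWin.lean`.
-/

namespace Summit.QuantumFields.BalabanUV.T4Continuum.T4TrajectoryDensityDressed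

open MeasureTheory Set Metric Filter
open Literature.MathematicalPhysics.QuantumFieldTheory.Balaban1983to89
open T4TermFormat T4TermFormat.Booking T4GatedBooking T4TrajectoryComparison T4TrajectoryModulus
open T4BirthChartTransport (GaugeInvariant BirthSlice RelGauge)
open T4BlockTransport (Fld NDir latMove latN latMove_zero)
open T4TrajectoryDensity

noncomputable section

/-! ## §25a The step law with the upper pairs AND the operation's slice windowed at their own guard [folklore] -/

section StepLaw

variable {𝒰 Dir F : Type*} [NormedAddCommGroup F] [NormedSpace ℂ F] [CompleteSpace F]
  {move : 𝒰 → Dir → ℂ → 𝒰} {N : Dir → ℝ} {w : ℝ}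

/-- **THE STEP LAW FROM THE OPERATION'S SLICES, UPPER PAIRS AND THE OPERATION'S SLICE WINDOWED AT `w₁`** —
`T4TrajectoryDensityPerWindow.contStepLawOn_of_opSlice_windowed₂` VERBATIM except that the step operation's own slice `hEsl` is
asked only on the direction window `w₁` of the upper pairs (not on the law's range `w`): the background-Lipschitz field tests the
slice only along the direction of a windowed upper pair, whose declared bound is `≤ δ ≤ w₁` (`bgLip_of_opSlice (w := w₁) … hadm.1
hadm.2`).  The law's range `w` survives only as the bound `ω ≤ w` on the fluctuation pair's defect. [folklore] -/
theorem contStepLawOn_of_opSlice_windowed₃ {Z : Type*} {𝒢 : Set (Z → F)} {E : 𝒰 → (Z → F) → F}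
    {act : Z → 𝒰 → 𝒰} {D : Set Z} {𝒦 : Set 𝒰} {Adm' : 𝒰 → 𝒰 → ℝ → Prop} {ϱ a ω w₁ : ℝ}
    (hD : D.Nonempty) (hϱ : 0 < ϱ) (hmove : ∀ U d, move U d 0 = U)
    (hsup : ∀ U₀ ∈ 𝒦, ∀ g ∈ 𝒢, ∀ g' ∈ 𝒢, ∀ (m : ℝ), (∀ z ∈ D, ‖g z - g' z‖ ≤ m) → ‖E U₀ g - E U₀ g'‖ ≤ a * m)
    (hEsl : ∀ g ∈ 𝒢, ∀ (c : F) (m : ℝ), (∀ z ∈ D, ‖g z - c‖ ≤ m) →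
      BirthSlice (fun U => E U g - c) move N 𝒦 w₁ ϱ (a * m))
    (hcov : ∀ (U₀ U₁ : 𝒰) (δ : ℝ), RawAdm move N 𝒦 U₀ U₁ δ → δ ≤ w₁ → ∀ z ∈ D, Adm' (act z U₀) (act z U₁) δ)
    (hpair : ∀ (U₀ U₁ : 𝒰) (δ : ℝ), RawAdm move N 𝒦 U₀ U₁ δ → δ ≤ w₁ → ∀ z ∈ D, ∀ z' ∈ D, z ≠ z' →
      Adm' (act z' U₁) (act z U₁) ω)
    (hω0 : 0 ≤ ω) (hωw : ω ≤ w) :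
    ContStepLawOn 𝒢 E act D (Windowed (RawAdm move N 𝒦) w₁) Adm' w a (4 * a / ϱ) ω where
  supCost := fun U₀ _ _ hadm _ g hg g' hg' m hm => hsup U₀ hadm.1.1 g hg g' hg' m hm
  bgLip := fun U₀ U₁ δ hadm _ => bgLip_of_opSlice hD hϱ hmove hEsl U₀ U₁ δ hadm.1 hadm.2
  covariant := fun U₀ U₁ δ hadm => hcov U₀ U₁ δ hadm.1 hadm.2
  fluctPair := fun U₀ U₁ δ hadm => hpair U₀ U₁ δ hadm.1 hadm.2
  ω_nonneg := hω0
  ω_le := hωw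

omit [NormedSpace ℂ F] [CompleteSpace F] in
/-- A modulus on raw pairs of range `w′` is a modulus of ANY range on the pairs windowed at `w′` (the window carries the
defect bound). [arith] [folklore] -/
theorem respMod_windowed_of_raw {G : 𝒰 → F} {N : Dir → ℝ} {𝒦 : Set 𝒰} {w w' M : ℝ}
    (h : RespMod G (RawAdm move N 𝒦) w' M) : RespMod G (Windowed (RawAdm move N 𝒦) w') w M :=
  fun U₀ U₁ δ hadm _ => h U₀ U₁ δ hadm.1 hadm.2

end StepLaw

/-! ## §25b The per-family pipeline with per-step chart AND SLICE windows [folklore] -/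

section PerSliceWindowAbstract

variable {B : Booking} {T : Trajectory B}
variable {𝒰 Dir F : Type*} [NormedAddCommGroup F] [NormedSpace ℂ F] [CompleteSpace F]
variable {move : 𝒰 → Dir → ℂ → 𝒰} {w r : ℝ}

/-- **THE WINDOW-GUARDED PIPELINE FROM OPERATOR SLICES, PER FAMILY, PER-STEP CHART AND SLICE WINDOWS** —
`transportsFromVar_of_opSlices_fam_win` VERBATIM except that the SLICES are per step too: the birth slice of generation `(b, k′)`
is asked on the direction window `wk b k′ k′` (its birth step's window) and the step operation's slice `hEsl` at step `k` on
`wk b k′ (k+1)`; the moduli are carried on the pairs windowed at `wk b k′ k` with range `w` (`respMod_windowed_of_raw`), the step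
law is `contStepLawOn_of_opSlice_windowed₃`.  SAME conclusion. [folklore] -/
theorem transportsFromVar_of_opSlices_fam_swin {Z : Type*} {Gate : ℕ → Prop} {Fn : B.Birth → ℕ → ℕ → 𝒰 → F}
    {rel : B.Birth → ℕ → ℕ → 𝒰 → 𝒰 → Prop} {Nk : B.Birth → ℕ → ℕ → Dir → ℝ} {𝒦 : B.Birth → ℕ → ℕ → Set 𝒰}
    {𝒢 : B.Birth → ℕ → Set (Z → F)} {E : B.Birth → ℕ → 𝒰 → (Z → F) → F} {act : B.Birth → ℕ → Z → 𝒰 → 𝒰}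
    {D : B.Birth → ℕ → Set Z} {defect wk : B.Birth → ℕ → ℕ → ℝ} {cδ ψ : ℝ} {a : B.Birth → ℕ → ℝ} {α : ℕ → ℝ}
    {ϱ ω : B.Birth → ℕ → ℕ → ℝ}
    (hα : ∀ i, 0 ≤ α i) (hr : 0 < r) (hmove : ∀ U d, move U d 0 = U)
    (hsl : ∀ (b : B.Birth) (k' : ℕ), B.birthScale b ≤ k' → k' ≤ B.K → RanBelow Gate k' →
      BirthSlice (Fn b k' k') move (Nk b k' k') (𝒦 b k' k') (wk b k' k') r (T.gen b k'))
    (hFn : ∀ (b : B.Birth) (k' k : ℕ), B.birthScale b ≤ k' → k' ≤ k → k + 1 ≤ B.K → RanBelow Gate (k + 1) →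
      ∀ U, Fn b k' (k + 1) U = E b k U (fun z => Fn b k' k (act b k z U)))
    (h𝒢 : ∀ (b : B.Birth) (k' k : ℕ), B.birthScale b ≤ k' → k' ≤ k → k + 1 ≤ B.K → RanBelow Gate (k + 1) →
      ∀ U, (fun z => Fn b k' k (act b k z U)) ∈ 𝒢 b k)
    (hD : ∀ b k, (D b k).Nonempty) (hϱ : ∀ b k' k, 0 < ϱ b k' k)
    (hsup : ∀ (b : B.Birth) (k' k : ℕ), B.birthScale b ≤ k' → k' ≤ k → k + 1 ≤ B.K → RanBelow Gate (k + 1) →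
      ∀ U₀ ∈ 𝒦 b k' (k + 1), ∀ g ∈ 𝒢 b k, ∀ g' ∈ 𝒢 b k, ∀ (m : ℝ), (∀ z ∈ D b k, ‖g z - g' z‖ ≤ m) →
        ‖E b k U₀ g - E b k U₀ g'‖ ≤ a b k * m)
    (hEsl : ∀ (b : B.Birth) (k' k : ℕ), B.birthScale b ≤ k' → k' ≤ k → k + 1 ≤ B.K → RanBelow Gate (k + 1) →
      ∀ g ∈ 𝒢 b k, ∀ (c : F) (m : ℝ), (∀ z ∈ D b k, ‖g z - c‖ ≤ m) →
        BirthSlice (fun U => E b k U g - c) move (Nk b k' (k + 1)) (𝒦 b k' (k + 1)) (wk b k' (k + 1)) (ϱ b k' k)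
          (a b k * m))
    (hcov : ∀ (b : B.Birth) (k' k : ℕ), B.birthScale b ≤ k' → k' ≤ k → k + 1 ≤ B.K → RanBelow Gate (k + 1) →
      ∀ (U₀ U₁ : 𝒰) (δ : ℝ), RawAdm move (Nk b k' (k + 1)) (𝒦 b k' (k + 1)) U₀ U₁ δ → δ ≤ wk b k' (k + 1) →
        ∀ z ∈ D b k, RawAdm move (Nk b k' k) (𝒦 b k' k) (act b k z U₀) (act b k z U₁) δ)
    (hpair : ∀ (b : B.Birth) (k' k : ℕ), B.birthScale b ≤ k' → k' ≤ k → k + 1 ≤ B.K → RanBelow Gate (k + 1) →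
      ∀ (U₀ U₁ : 𝒰) (δ : ℝ), RawAdm move (Nk b k' (k + 1)) (𝒦 b k' (k + 1)) U₀ U₁ δ → δ ≤ wk b k' (k + 1) →
        ∀ z ∈ D b k, ∀ z' ∈ D b k, z ≠ z' →
          RawAdm move (Nk b k' k) (𝒦 b k' k) (act b k z' U₁) (act b k z U₁) (ω b k' k))
    (hω : ∀ b k' k, 0 ≤ ω b k' k ∧ ω b k' k ≤ wk b k' k)
    (hwk : ∀ b k' k, wk b k' k ≤ w) (hwk_anti : ∀ b k' k, wk b k' (k + 1) ≤ wk b k' k)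
    (hdom : ∀ (b : B.Birth) (k' k : ℕ), B.birthScale b ≤ k' → k' ≤ k → k + 1 ≤ B.K →
      a b k * (1 + 4 * ω b k' k / ϱ b k' k) ≤ α k)
    (hinv : ∀ b k' k, GaugeInvariant (rel b k' k) (Fn b k' k))
    (hdefwk : ∀ b k' k, defect b k' k ≤ wk b k' k)
    (hrate : ∀ (b : B.Birth) (k' k : ℕ), B.birthScale b ≤ k' → k' ≤ k → k ≤ B.K →
      defect b k' k ≤ cδ * ψ ^ (k - k'))
    (hlin : ∀ (b : B.Birth) (k' k : ℕ), B.birthScale b ≤ k' → k' ≤ k → k ≤ B.K → RanBelow Gate k → ∀ ε > 0,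
      ∃ U₀ ∈ 𝒦 b k' k, ∃ U₁ : 𝒰, RelGauge (rel b k' k) move (Nk b k' k) U₀ U₁ (defect b k' k) ∧
        T.lin b k' k ≤ ‖Fn b k' k U₁ - Fn b k' k U₀‖ + ε) :
    T.TransportsFromVar (4 * cδ / r) (fun i => ψ * α i) Gate := by
  have h := transportsFromVar_of_moduli_dep (T := T) (C₀ := 4 / r)
    (Adm := fun b k' k => Windowed (RawAdm move (Nk b k' k) (𝒦 b k' k)) (wk b k' k)) (by positivity) hα
    (fun b k' hbk' hk hran =>
      respMod_windowed_of_raw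
        ((respMod_raw_of_birthSlice (hsl b k' hbk' hk hran) hmove hr (T.gen_nonneg b k')).congr_const (by ring)))
    (cont_of_contStepLawOn_fam (Adm := fun b k' k => Windowed (RawAdm move (Nk b k' k) (𝒦 b k' k)) (wk b k' k))
      (𝒢 := 𝒢) (D := D) (ℓ := fun b k' k => 4 * a b k / ϱ b k' k) (ω := ω)
      (fun b k' k U₀ U₁ δ hadm => rawAdm_nonneg hadm.1) hFn h𝒢
      (fun b k' k hbk' hk'k hk hran => contStepLawOn_of_opSlice_windowed₃ (hD b k) (hϱ b k' k) hmove
        (hsup b k' k hbk' hk'k hk hran) (hEsl b k' k hbk' hk'k hk hran)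
        (fun U₀ U₁ δ hadm hδ z hz =>
          ⟨hcov b k' k hbk' hk'k hk hran U₀ U₁ δ hadm hδ z hz, hδ.trans (hwk_anti b k' k)⟩)
        (fun U₀ U₁ δ hadm hδ z hz z' hz' hzz =>
          ⟨hpair b k' k hbk' hk'k hk hran U₀ U₁ δ hadm hδ z hz z' hz' hzz, (hω b k' k).2⟩)
        (hω b k' k).1 ((hω b k' k).2.trans (hwk b k' k)))
      (fun b k' k hbk' hk'k hk => by
        show a b k + 4 * a b k / ϱ b k' k * ω b k' k ≤ α k
        rw [stepFactor_eq]
        exact hdom b k' k hbk' hk'k hk))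
    (fun b k' k => (hdefwk b k' k).trans (hwk b k' k)) hrate
    (fun b k' k hbk' hk'k hk hran ε hε => by
      obtain ⟨U₀, hU₀, U₁, ⟨dd, hd, hdδ, hrel⟩, hle⟩ := hlin b k' k hbk' hk'k hk hran ε hε
      refine ⟨U₀, move U₀ dd 1, ⟨⟨hU₀, dd, hd, hdδ, rfl⟩, hdefwk b k' k⟩, ?_⟩
      rwa [hinv b k' k _ _ hrel] at hle)
  have e : 4 / r * cδ = 4 * cδ / r := by ring
  rw [e] at h
  exact h

/-- **THE CLASS-GUARDED LINEAR-OPERATION PIPELINE, PER FAMILY, PER-STEP CHART AND SLICE WINDOWS** —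
`transportsFromVar_of_linearOpSlicesOn_fam_win` VERBATIM except: birth slices on `wk b k′ k′`, the operator slice `hop` of step
`k` on the window `wk b k′ (k+1)`, and the admissible direction `hdir` inside that window. [folklore] -/
theorem transportsFromVar_of_linearOpSlicesOn_fam_swin {Z : Type*} {Gate : ℕ → Prop} {Fn : B.Birth → ℕ → ℕ → 𝒰 → F}
    {rel : B.Birth → ℕ → ℕ → 𝒰 → 𝒰 → Prop} {Nk : B.Birth → ℕ → ℕ → Dir → ℝ} {𝒦 : B.Birth → ℕ → ℕ → Set 𝒰}
    {𝒢 : B.Birth → ℕ → Set (Z → F)} {E : B.Birth → ℕ → 𝒰 → (Z → F) → F} {act : B.Birth → ℕ → Z → 𝒰 → 𝒰}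
    {D : B.Birth → ℕ → Set Z} {defect wk : B.Birth → ℕ → ℕ → ℝ} {cδ ψ : ℝ} {a : B.Birth → ℕ → ℝ} {α : ℕ → ℝ}
    {ϱ ω : B.Birth → ℕ → ℕ → ℝ}
    (hα : ∀ i, 0 ≤ α i) (hr : 0 < r) (hmove : ∀ U d, move U d 0 = U)
    (hsl : ∀ (b : B.Birth) (k' : ℕ), B.birthScale b ≤ k' → k' ≤ B.K → RanBelow Gate k' →
      BirthSlice (Fn b k' k') move (Nk b k' k') (𝒦 b k' k') (wk b k' k') r (T.gen b k'))
    (hFn : ∀ (b : B.Birth) (k' k : ℕ), B.birthScale b ≤ k' → k' ≤ k → k + 1 ≤ B.K → RanBelow Gate (k + 1) →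
      ∀ U, Fn b k' (k + 1) U = E b k U (fun z => Fn b k' k (act b k z U)))
    (h𝒢 : ∀ (b : B.Birth) (k' k : ℕ), B.birthScale b ≤ k' → k' ≤ k → k + 1 ≤ B.K → RanBelow Gate (k + 1) →
      ∀ U, (fun z => Fn b k' k (act b k z U)) ∈ 𝒢 b k)
    (hD : ∀ b k, (D b k).Nonempty) (hϱ : ∀ b k' k, 0 < ϱ b k' k)
    (h𝒢c : ∀ (b : B.Birth) (k : ℕ) (c : F), (fun _ : Z => c) ∈ 𝒢 b k)
    (h𝒢s : ∀ (b : B.Birth) (k : ℕ), ∀ g ∈ 𝒢 b k, ∀ g' ∈ 𝒢 b k, g - g' ∈ 𝒢 b k)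
    (hsub : ∀ (b : B.Birth) (k : ℕ) (U : 𝒰), ∀ g ∈ 𝒢 b k, ∀ g' ∈ 𝒢 b k, E b k U (g - g') = E b k U g - E b k U g')
    (hnorm : ∀ (b : B.Birth) (k : ℕ) (U : 𝒰) (c : F), E b k U (fun _ => c) = c)
    (hop : ∀ (b : B.Birth) (k' k : ℕ), B.birthScale b ≤ k' → k' ≤ k → k + 1 ≤ B.K → RanBelow Gate (k + 1) →
      OpSliceOn (𝒢 b k) (E b k) (D b k) move (Nk b k' (k + 1)) (𝒦 b k' (k + 1)) (wk b k' (k + 1)) (ϱ b k' k) (a b k))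
    (hdir : ∀ (b : B.Birth) (k' k : ℕ), B.birthScale b ≤ k' → k' ≤ k → k + 1 ≤ B.K →
      ∃ d : Dir, 0 < Nk b k' (k + 1) d ∧ Nk b k' (k + 1) d ≤ wk b k' (k + 1))
    (hcov : ∀ (b : B.Birth) (k' k : ℕ), B.birthScale b ≤ k' → k' ≤ k → k + 1 ≤ B.K → RanBelow Gate (k + 1) →
      ∀ (U₀ U₁ : 𝒰) (δ : ℝ), RawAdm move (Nk b k' (k + 1)) (𝒦 b k' (k + 1)) U₀ U₁ δ → δ ≤ wk b k' (k + 1) →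
        ∀ z ∈ D b k, RawAdm move (Nk b k' k) (𝒦 b k' k) (act b k z U₀) (act b k z U₁) δ)
    (hpair : ∀ (b : B.Birth) (k' k : ℕ), B.birthScale b ≤ k' → k' ≤ k → k + 1 ≤ B.K → RanBelow Gate (k + 1) →
      ∀ (U₀ U₁ : 𝒰) (δ : ℝ), RawAdm move (Nk b k' (k + 1)) (𝒦 b k' (k + 1)) U₀ U₁ δ → δ ≤ wk b k' (k + 1) →
        ∀ z ∈ D b k, ∀ z' ∈ D b k, z ≠ z' →
          RawAdm move (Nk b k' k) (𝒦 b k' k) (act b k z' U₁) (act b k z U₁) (ω b k' k))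
    (hω : ∀ b k' k, 0 ≤ ω b k' k ∧ ω b k' k ≤ wk b k' k)
    (hwk : ∀ b k' k, wk b k' k ≤ w) (hwk_anti : ∀ b k' k, wk b k' (k + 1) ≤ wk b k' k)
    (hdom : ∀ (b : B.Birth) (k' k : ℕ), B.birthScale b ≤ k' → k' ≤ k → k + 1 ≤ B.K →
      a b k * (1 + 4 * ω b k' k / ϱ b k' k) ≤ α k)
    (hinv : ∀ b k' k, GaugeInvariant (rel b k' k) (Fn b k' k))
    (hdefwk : ∀ b k' k, defect b k' k ≤ wk b k' k)
    (hrate : ∀ (b : B.Birth) (k' k : ℕ), B.birthScale b ≤ k' → k' ≤ k → k ≤ B.K →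
      defect b k' k ≤ cδ * ψ ^ (k - k'))
    (hlin : ∀ (b : B.Birth) (k' k : ℕ), B.birthScale b ≤ k' → k' ≤ k → k ≤ B.K → RanBelow Gate k → ∀ ε > 0,
      ∃ U₀ ∈ 𝒦 b k' k, ∃ U₁ : 𝒰, RelGauge (rel b k' k) move (Nk b k' k) U₀ U₁ (defect b k' k) ∧
        T.lin b k' k ≤ ‖Fn b k' k U₁ - Fn b k' k U₀‖ + ε) :
    T.TransportsFromVar (4 * cδ / r) (fun i => ψ * α i) Gate :=
  transportsFromVar_of_opSlices_fam_swin hα hr hmove hsl hFn h𝒢 hD hϱ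
    (fun b k' k hbk' hk'k hk hran =>
      supCost_of_opSliceOn (h𝒢s b k) (hsub b k) (hop b k' k hbk' hk'k hk hran) hmove (hϱ b k' k).le
        (hdir b k' k hbk' hk'k hk))
    (fun b k' k hbk' hk'k hk hran =>
      opSliceOn_centred (h𝒢c b k) (h𝒢s b k) (hsub b k) (hnorm b k) (hop b k' k hbk' hk'k hk hran))
    hcov hpair hω hwk hwk_anti hdom hinv hdefwk hrate hlin

end PerSliceWindowAbstract

/-! ## §25c On `ℤ^d`: (N2) and every slice at the next step's window; the gated dressed-centred capstone [folklore] -/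

section PerSliceWindowLattice

variable {B : Booking} {T : Trajectory B}
variable {R : Type*} [NormedRing R] [NormedAlgebra ℂ R] {d : ℕ}
  {F : Type*} [NormedAddCommGroup F] [NormedSpace ℂ F] [CompleteSpace F]

/-- **ON `ℤ^d`, PER FAMILY, PER-STEP CHART AND SLICE WINDOWS** — `transportsFromVar_of_linearOpSlicesOn_lattice_fam_win` VERBATIM
except: birth slices on `wk b k′ k′`, the operator slice of step `k` on `wk b k′ (k+1)` (the admissible direction is supplied
inside that window by `hdir_lattice`, positivity from `0 < θ b (k+1) ≤ wk b k′ (k+1)`). [folklore] -/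
theorem transportsFromVar_of_linearOpSlicesOn_lattice_fam_swin {Gate : ℕ → Prop} {Fn : B.Birth → ℕ → ℕ → Fld d R → F}
    {rel : B.Birth → ℕ → ℕ → Fld d R → Fld d R → Prop} {𝒦 : B.Birth → ℕ → ℕ → Set (Fld d R)}
    {𝒢 : B.Birth → ℕ → Set (Fld d R → F)} {E : B.Birth → ℕ → Fld d R → (Fld d R → F) → F}
    {D : B.Birth → ℕ → Set (Fld d R)} {defect wk : B.Birth → ℕ → ℕ → ℝ} {cδ ψ w r : ℝ}
    {a θ : B.Birth → ℕ → ℝ} {α : ℕ → ℝ} {ϱ : B.Birth → ℕ → ℕ → ℝ}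
    (hα : ∀ i, 0 ≤ α i) (hr : 0 < r)
    (hsl : ∀ (b : B.Birth) (k' : ℕ), B.birthScale b ≤ k' → k' ≤ B.K → RanBelow Gate k' →
      BirthSlice (Fn b k' k') latMove latN (𝒦 b k' k') (wk b k' k') r (T.gen b k'))
    (hFn : ∀ (b : B.Birth) (k' k : ℕ), B.birthScale b ≤ k' → k' ≤ k → k + 1 ≤ B.K → RanBelow Gate (k + 1) →
      ∀ U, Fn b k' (k + 1) U = E b k U (fun z => Fn b k' k (U + z)))
    (h𝒢 : ∀ (b : B.Birth) (k' k : ℕ), B.birthScale b ≤ k' → k' ≤ k → k + 1 ≤ B.K → RanBelow Gate (k + 1) →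
      ∀ U, (fun z => Fn b k' k (U + z)) ∈ 𝒢 b k)
    (hD : ∀ b k, (D b k).Nonempty) (hϱ : ∀ b k' k, 0 < ϱ b k' k)
    (h𝒢c : ∀ (b : B.Birth) (k : ℕ) (c : F), (fun _ : Fld d R => c) ∈ 𝒢 b k)
    (h𝒢s : ∀ (b : B.Birth) (k : ℕ), ∀ g ∈ 𝒢 b k, ∀ g' ∈ 𝒢 b k, g - g' ∈ 𝒢 b k)
    (hsub : ∀ (b : B.Birth) (k : ℕ) (U : Fld d R), ∀ g ∈ 𝒢 b k, ∀ g' ∈ 𝒢 b k,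
      E b k U (g - g') = E b k U g - E b k U g')
    (hnorm : ∀ (b : B.Birth) (k : ℕ) (U : Fld d R) (c : F), E b k U (fun _ => c) = c)
    (hop : ∀ (b : B.Birth) (k' k : ℕ), B.birthScale b ≤ k' → k' ≤ k → k + 1 ≤ B.K → RanBelow Gate (k + 1) →
      OpSliceOn (𝒢 b k) (E b k) (D b k) latMove latN (𝒦 b k' (k + 1)) (wk b k' (k + 1)) (ϱ b k' k) (a b k))
    (hN1 : ∀ (b : B.Birth) (k' k : ℕ), B.birthScale b ≤ k' → k' ≤ k → k + 1 ≤ B.K →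
      ∀ z ∈ D b k, ∀ U ∈ 𝒦 b k' (k + 1), U + z ∈ 𝒦 b k' k)
    (hN2 : ∀ (b : B.Birth) (k' k : ℕ), B.birthScale b ≤ k' → k' ≤ k → k + 1 ≤ B.K →
      ∀ U₀ ∈ 𝒦 b k' (k + 1), ∀ p : NDir d R, latN p ≤ wk b k' (k + 1) → ∀ z' ∈ D b k,
        latMove U₀ p 1 + z' ∈ 𝒦 b k' k)
    (hdiam : ∀ b k, ∀ z ∈ D b k, ∀ z' ∈ D b k, ∀ x ν, ‖z x ν - z' x ν‖ ≤ θ b k)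
    (hθ : ∀ b k, 0 < θ b k ∧ θ b k ≤ w) (hθwk : ∀ b k' k, θ b k ≤ wk b k' k)
    (hwk : ∀ b k' k, wk b k' k ≤ w) (hwk_anti : ∀ b k' k, wk b k' (k + 1) ≤ wk b k' k)
    (hdom : ∀ (b : B.Birth) (k' k : ℕ), B.birthScale b ≤ k' → k' ≤ k → k + 1 ≤ B.K →
      a b k * (1 + 4 * θ b k / ϱ b k' k) ≤ α k)
    (hinv : ∀ b k' k, GaugeInvariant (rel b k' k) (Fn b k' k))
    (hdefwk : ∀ b k' k, defect b k' k ≤ wk b k' k)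
    (hrate : ∀ (b : B.Birth) (k' k : ℕ), B.birthScale b ≤ k' → k' ≤ k → k ≤ B.K →
      defect b k' k ≤ cδ * ψ ^ (k - k'))
    (hlin : ∀ (b : B.Birth) (k' k : ℕ), B.birthScale b ≤ k' → k' ≤ k → k ≤ B.K → RanBelow Gate k → ∀ ε > 0,
      ∃ U₀ ∈ 𝒦 b k' k, ∃ U₁ : Fld d R, RelGauge (rel b k' k) latMove latN U₀ U₁ (defect b k' k) ∧
        T.lin b k' k ≤ ‖Fn b k' k U₁ - Fn b k' k U₀‖ + ε) :
    T.TransportsFromVar (4 * cδ / r) (fun i => ψ * α i) Gate :=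
  transportsFromVar_of_linearOpSlicesOn_fam_swin (act := fun _ _ z U => U + z) (Nk := fun _ _ _ => latN)
    (ϱ := ϱ) (ω := fun b _ k => θ b k) hα hr latMove_zero hsl hFn h𝒢 hD hϱ h𝒢c h𝒢s hsub hnorm hop
    (fun b k' k _ _ _ => hdir_lattice ((hθ b (k + 1)).1.trans_le (hθwk b k' (k + 1))))
    (fun b k' k hbk' hk'k hk _ U₀ U₁ δ hadm _ z hz => hcov_add (hN1 b k' k hbk' hk'k hk) U₀ U₁ δ hadm z hz)
    (fun b k' k hbk' hk'k hk _ => hpair_add (hθ b k).1 (hdiam b k) (hN2 b k' k hbk' hk'k hk))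
    (fun b k' k => ⟨(hθ b k).1.le, hθwk b k' k⟩) hwk hwk_anti hdom hinv hdefwk hrate hlin

variable [MeasurableSpace R]

/-- **THE PER-FAMILY CENTRED CAPSTONE, BUDGET UNDER THE HISTORY, PER-STEP CHART AND SLICE WINDOWS** —
`transportsFromVar_of_centredExponent_lattice_fam_gated_win` VERBATIM except that EVERY slice is per step: births `hsl` on the
direction window `wk b k′ k′`, the action exponent `hE` and the centred perturbation `hP` of the met step `k` on `wk b k′ (k+1)`
(so the produced operator slice, `opSliceOn_wOp_dressed`, is on that window).  SAME conclusion `T.TransportsFromVar (4c_δ/r)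
(fun i => ψ·α i) Gate`, same constants.  Since the slice shapes are `∀ d, 0 < N d → N d ≤ w → …` (antitone in the window),
these binders are WEAKER than the `_win` ones; the gain is downstream: the cross-family complex margin that assembles `hP` need
only be asked for directions `≤ wk b k′ (k+1)` (finding F-ne1pleaf04-1). [folklore] -/
theorem transportsFromVar_of_centredExponent_lattice_fam_gated_swin {Gate : ℕ → Prop}
    {Fn : B.Birth → ℕ → ℕ → Fld d R → F}
    {rel : B.Birth → ℕ → ℕ → Fld d R → Fld d R → Prop} {𝒦 : B.Birth → ℕ → ℕ → Set (Fld d R)}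
    {ref : B.Birth → ℕ → Fld d R → Fld d R} {base : B.Birth → ℕ → Fld d R → ℝ}
    {𝒜 𝒬 : B.Birth → ℕ → Fld d R → Fld d R → ℂ} {q : B.Birth → ℕ → Fld d R → ℂ}
    {μ : B.Birth → ℕ → Measure (Fld d R)} {z₀ : B.Birth → ℕ → Fld d R} {D : B.Birth → ℕ → Set (Fld d R)}
    {defect wk : B.Birth → ℕ → ℕ → ℝ} {cδ ψ w r : ℝ} {s s₁ θ : B.Birth → ℕ → ℝ} {α : ℕ → ℝ}
    {ϱ : B.Birth → ℕ → ℕ → ℝ}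
    (hα : ∀ i, 0 ≤ α i) (hr : 0 < r)
    (hsl : ∀ (b : B.Birth) (k' : ℕ), B.birthScale b ≤ k' → k' ≤ B.K → RanBelow Gate k' →
      BirthSlice (Fn b k' k') latMove latN (𝒦 b k' k') (wk b k' k') r (T.gen b k'))
    (hFn : ∀ (b : B.Birth) (k' k : ℕ), B.birthScale b ≤ k' → k' ≤ k → k + 1 ≤ B.K → RanBelow Gate (k + 1) →
      ∀ U, Fn b k' (k + 1) U =
        wOp (expWeight (base b k) (𝒜 b k + 𝒬 b k)) (μ b k) (z₀ b k) U (fun z => Fn b k' k (U + z)))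
    (h𝒢 : ∀ (b : B.Birth) (k' k : ℕ), B.birthScale b ≤ k' → k' ≤ k → k + 1 ≤ B.K → RanBelow Gate (k + 1) →
      ∀ U, (fun z => Fn b k' k (U + z)) ∈ BddClass F (μ b k))
    (hD : ∀ b k, (D b k).Nonempty) (hϱ : ∀ b k' k, 0 < ϱ b k' k)
    (hB : ∀ (b : B.Birth) (k' k : ℕ), B.birthScale b ≤ k' → k' ≤ k → k + 1 ≤ B.K → RanBelow Gate (k + 1) →
      RealBaseAt (ref b k) (base b k) (𝒜 b k) (μ b k) (𝒦 b k' (k + 1)))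
    (hE : ∀ (b : B.Birth) (k' k : ℕ), B.birthScale b ≤ k' → k' ≤ k → k + 1 ≤ B.K → RanBelow Gate (k + 1) →
      ExponentSliceAt (ref b k) (𝒜 b k) (μ b k) latMove latN (𝒦 b k' (k + 1)) (wk b k' (k + 1)) (ϱ b k' k) (s b k))
    (hP : ∀ (b : B.Birth) (k' k : ℕ), B.birthScale b ≤ k' → k' ≤ k → k + 1 ≤ B.K → RanBelow Gate (k + 1) →
      PertSlice (fun U z => 𝒬 b k U z - q b k U) (μ b k) latMove latN (𝒦 b k' (k + 1)) (wk b k' (k + 1)) (ϱ b k' k)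
        (s₁ b k))
    (hs : ∀ (b : B.Birth) (k' k : ℕ), B.birthScale b ≤ k' → k' ≤ k → k + 1 ≤ B.K → RanBelow Gate (k + 1) →
      s b k + s₁ b k ≤ 1)
    (hDμ : ∀ b k, ∀ᵐ z ∂μ b k, z ∈ D b k)
    (hN1 : ∀ (b : B.Birth) (k' k : ℕ), B.birthScale b ≤ k' → k' ≤ k → k + 1 ≤ B.K →
      ∀ z ∈ D b k, ∀ U ∈ 𝒦 b k' (k + 1), U + z ∈ 𝒦 b k' k)
    (hN2 : ∀ (b : B.Birth) (k' k : ℕ), B.birthScale b ≤ k' → k' ≤ k → k + 1 ≤ B.K →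
      ∀ U₀ ∈ 𝒦 b k' (k + 1), ∀ p : NDir d R, latN p ≤ wk b k' (k + 1) → ∀ z' ∈ D b k,
        latMove U₀ p 1 + z' ∈ 𝒦 b k' k)
    (hdiam : ∀ b k, ∀ z ∈ D b k, ∀ z' ∈ D b k, ∀ x ν, ‖z x ν - z' x ν‖ ≤ θ b k)
    (hθ : ∀ b k, 0 < θ b k ∧ θ b k ≤ w) (hθwk : ∀ b k' k, θ b k ≤ wk b k' k)
    (hwk : ∀ b k' k, wk b k' k ≤ w) (hwk_anti : ∀ b k' k, wk b k' (k + 1) ≤ wk b k' k)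
    (hdom : ∀ (b : B.Birth) (k' k : ℕ), B.birthScale b ≤ k' → k' ≤ k → k + 1 ≤ B.K →
      Real.exp 3 * (1 + 4 * θ b k / ϱ b k' k) ≤ α k)
    (hinv : ∀ b k' k, GaugeInvariant (rel b k' k) (Fn b k' k))
    (hdefwk : ∀ b k' k, defect b k' k ≤ wk b k' k)
    (hrate : ∀ (b : B.Birth) (k' k : ℕ), B.birthScale b ≤ k' → k' ≤ k → k ≤ B.K →
      defect b k' k ≤ cδ * ψ ^ (k - k'))
    (hlin : ∀ (b : B.Birth) (k' k : ℕ), B.birthScale b ≤ k' → k' ≤ k → k ≤ B.K → RanBelow Gate k → ∀ ε > 0,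
      ∃ U₀ ∈ 𝒦 b k' k, ∃ U₁ : Fld d R, RelGauge (rel b k' k) latMove latN U₀ U₁ (defect b k' k) ∧
        T.lin b k' k ≤ ‖Fn b k' k U₁ - Fn b k' k U₀‖ + ε) :
    T.TransportsFromVar (4 * cδ / r) (fun i => ψ * α i) Gate := by
  have e : ∀ b k, 𝒜 b k + 𝒬 b k = (𝒜 b k + fun U z => 𝒬 b k U z - q b k U) + fun U _ => q b k U := fun b k => by
    funext U z
    simp only [Pi.add_apply]
    ring
  have hFn' : ∀ (b : B.Birth) (k' k : ℕ), B.birthScale b ≤ k' → k' ≤ k → k + 1 ≤ B.K → RanBelow Gate (k + 1) →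
      ∀ U, Fn b k' (k + 1) U =
        wOp (expWeight (base b k) (𝒜 b k + fun U z => 𝒬 b k U z - q b k U)) (μ b k) (z₀ b k) U
          (fun z => Fn b k' k (U + z)) := by
    intro b k' k h₁ h₂ h₃ h₄ U
    rw [hFn b k' k h₁ h₂ h₃ h₄ U, e b k, wOp_expWeight_add_zconst]
  exact transportsFromVar_of_linearOpSlicesOn_lattice_fam_swin (𝒢 := fun b k => BddClass F (μ b k))
    (E := fun b k => wOp (expWeight (base b k) (𝒜 b k + fun U z => 𝒬 b k U z - q b k U)) (μ b k) (z₀ b k))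
    (a := fun _ _ => Real.exp 3) (ϱ := ϱ) (θ := θ)
    hα hr hsl hFn' h𝒢 hD hϱ (fun b k c => const_mem_bddClass (μ b k) c)
    (fun b k _ hg _ hg' => sub_mem_bddClass hg hg')
    (fun b k U _ hg _ hg' => wOp_sub _ (μ b k) (z₀ b k) U hg hg')
    (fun b k U c => wOp_const _ (μ b k) (z₀ b k) U c)
    (fun b k' k hbk' hk'k hk hran =>
      opSliceOn_mono_const (hD b k)
        (opSliceOn_wOp_dressed (z₀ b k) (hB b k' k hbk' hk'k hk hran) (hE b k' k hbk' hk'k hk hran)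
          (hP b k' k hbk' hk'k hk hran) (hs b k' k hbk' hk'k hk hran) (hDμ b k))
        (Real.exp_le_exp.mpr (by linarith [hs b k' k hbk' hk'k hk hran])))
    hN1 hN2 hdiam hθ hθwk hwk hwk_anti hdom hinv hdefwk hrate hlin

end PerSliceWindowLattice

end

end Summit.QuantumFields.BalabanUV.T4Continuum.T4TrajectoryDensityDressed
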